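import Summits.BirchSwinnertonDyer.BirchSwinnertonDyer.Theorems.DefiniteThetaDerivedHeightCapTowerSqrtAcLayerCyclic
import HarnessLib

/-!
# Coherent generators of the layer groups `Pic(𝒪_{p^{n+1}})/Δ` and their unbounded orders

Route-independent `Theorems` file (cell `b2b-bsdres`, seat `b2b-bsdres-x10b`, gen 44), part 7 of the series «tower square root»
serving crux `DerivedHeightCap` (stmt-BirchSwinnertonDyer-18438, route DefiniteTheta), registered stub `stub_towerSqrt`.
HONEST FRAMING: no curve asserted, no class closed, BSD not proved by any of this.

`K` imaginary quadratic, `p` odd; `G̃_m = Pic(𝒪_{p^m})`, `Δ_m = torsionImage K p m`, `Q_m = G̃_m/Δ_m` (cyclic, part 6). The data the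
abstract square-root theorem (part 3) consumes, stated WITHOUT the quotient type wherever possible (its typeclass search is slow in
this import closure; proofs install the local instance `IsMulCommutative (ClassGroup _)` first):

* §1 `exists_coherent_generators_mod_torsionImage`: classes `d_n ∈ G̃_{n+1}`, `res d_{n+1} = d_n`, each generating `G̃_{n+1}` modulo
  `Δ_{n+1}` — a generator at level `2` lifted coherently up the tower generates every higher layer (generator transfer in cyclic
  `p`-groups, part 4 §2, through the non-trivial quotient `Q_2`), and its restriction generates `Q_1`.
* §2 `exists_natCard_acLayerGroup_eq`: `#Q_{n+1} = p^{e_n}` with `e_n ≥ n` (part 6 §4), so `e` is unbounded.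

## References
* [BertoliniDarmon2005] §1.2 (18)–(21); [DarmonIovita2008] §2.2; [Washington1997] §13.2.
-/

noncomputable section

open scoped BigOperators

-- D-0017: single-problem summit, the namespace repeats the problem name by design.
set_option linter.dupNamespace false

namespace Summit.BirchSwinnertonDyer.BirchSwinnertonDyer.Theorems.TowerSqrt

open Literature.NumberTheory.EllipticCurves Literature.NumberTheory.EllipticCurves.QuadOrderTower NumberField
open Summit.BirchSwinnertonDyer.BirchSwinnertonDyer.Theorems.DefmuSupersingularTheta
  (picRes_mem_torsionImage picRes_surjective_tower)

universe u

variable {K : Type u} [Field K] [NumberField K] (p : ℕ) [hp : Fact p.Prime]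

/-! ### §1 Coherent generators -/

/-- Restriction transports generation modulo `Δ`: if `c` generates `G̃_{m}` modulo `Δ_m` and `G̃_m → G̃_n` is onto, then `res c`
generates `G̃_n` modulo `Δ_n`. [folklore] -/
theorem generates_mod_torsionImage_picRes {n m : ℕ} (hnm : n ≤ m) (c : ClassGroup (quadOrder K (p ^ m)))
    (hc : ∀ x : ClassGroup (quadOrder K (p ^ m)), ∃ i : ℕ, x * (c ^ i)⁻¹ ∈ torsionImage K p m)
    (hsurj : Function.Surjective (picRes K (pow_dvd_pow p hnm))) :
    ∀ x : ClassGroup (quadOrder K (p ^ n)), ∃ i : ℕ, x * (picRes K (pow_dvd_pow p hnm) c ^ i)⁻¹ ∈ torsionImage K p n := by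
  intro x
  obtain ⟨y, rfl⟩ := hsurj x
  obtain ⟨i, hi⟩ := hc y
  refine ⟨i, ?_⟩
  rw [← map_pow, ← map_inv, ← map_mul]
  exact picRes_mem_torsionImage p hnm hi

/-- **Generator transfer up the tower** (`K` imaginary quadratic, `p` odd): if `c₂` generates `G̃_2` modulo `Δ_2` and `d ∈ G̃_{n+2}`
restricts to `c₂`, then `d` generates `G̃_{n+2}` modulo `Δ_{n+2}` (in the cyclic `p`-group `Q_{n+2}` an element mapping to a generator
of the non-trivial quotient `Q_2` is a generator, part 4 §2). [cite: BertoliniDarmon2005, §1.2 (18)–(21)] -/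
theorem generates_mod_torsionImage_of_picRes_eq (hK : IsImaginaryQuadratic K) (hp2 : p ≠ 2) (n : ℕ)
    (c₂ : ClassGroup (quadOrder K (p ^ 2)))
    (hc₂ : ∀ x : ClassGroup (quadOrder K (p ^ 2)), ∃ i : ℕ, x * (c₂ ^ i)⁻¹ ∈ torsionImage K p 2)
    (d : ClassGroup (quadOrder K (p ^ (n + 2)))) (hd : picRes K (pow_dvd_pow p (by omega : 2 ≤ n + 2)) d = c₂) :
    ∀ x : ClassGroup (quadOrder K (p ^ (n + 2))), ∃ i : ℕ, x * (d ^ i)⁻¹ ∈ torsionImage K p (n + 2) := by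
  classical
  -- local instances: keep the typeclass search for the quotients away from `IsCyclic.isMulCommutative`
  haveI : ∀ m : ℕ, IsMulCommutative (ClassGroup (quadOrder K (p ^ m))) := fun m => CommMagma.to_isCommutative
  haveI : ∀ m : ℕ, Finite (ClassGroup (quadOrder K (p ^ m))) := fun m => finite_classGroup (K := K) _
  set N := torsionImage K p (n + 2) with hN
  set N₂ := torsionImage K p 2 with hN₂
  -- Q_{n+2} is a cyclic p-group
  obtain ⟨c, hc⟩ := exists_generator_mod_torsionImage p hK hp2 (n + 1)
  have hcyc : IsCyclic (ClassGroup (quadOrder K (p ^ (n + 2))) ⧸ N) := by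
    refine isCyclic_of_forall_exists_pow_eq (QuotientGroup.mk' N c) fun q => ?_
    obtain ⟨x, rfl⟩ := QuotientGroup.mk'_surjective N q
    obtain ⟨i, hi⟩ := hc x
    refine ⟨i, ?_⟩
    rw [← map_pow, QuotientGroup.mk'_apply, QuotientGroup.mk'_apply, QuotientGroup.eq]
    have : (c ^ i)⁻¹ * x = x * (c ^ i)⁻¹ := mul_comm _ _
    rw [this]; exact hi
  have hP : IsPGroup p (ClassGroup (quadOrder K (p ^ (n + 2))) ⧸ N) := isPGroup_acLayerGroup p hK (n + 1)
  have hP₂ : IsPGroup p (ClassGroup (quadOrder K (p ^ 2)) ⧸ N₂) := isPGroup_acLayerGroup p hK 1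
  -- Q_2 is non-trivial
  obtain ⟨h, -, hh⟩ := exists_pow_prime_pow_not_mem p hK hp2 0
  have hy : QuotientGroup.mk' N₂ (h ^ p ^ 0) ≠ 1 := by
    rw [QuotientGroup.mk'_apply]
    exact fun h1 => hh ((QuotientGroup.eq_one_iff _).mp h1)
  -- the map Q_{n+2} → Q_2
  have hle : N ≤ N₂.comap (picRes K (pow_dvd_pow p (by omega : 2 ≤ n + 2))) := fun t ht =>
    Subgroup.mem_comap.mpr (picRes_mem_torsionImage p (by omega) ht)
  set f := QuotientGroup.map N N₂ (picRes K (pow_dvd_pow p (by omega : 2 ≤ n + 2))) hle with hf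
  -- the image of [d] generates Q_2
  have hfd : ∀ y : ClassGroup (quadOrder K (p ^ 2)) ⧸ N₂, ∃ k : ℕ, (f (QuotientGroup.mk' N d)) ^ k = y := by
    intro y
    obtain ⟨x, rfl⟩ := QuotientGroup.mk'_surjective N₂ y
    obtain ⟨i, hi⟩ := hc₂ x
    refine ⟨i, ?_⟩
    rw [hf, QuotientGroup.mk'_apply, QuotientGroup.map_mk, hd, ← QuotientGroup.mk_pow, QuotientGroup.mk'_apply, QuotientGroup.eq]
    have : (c₂ ^ i)⁻¹ * x = x * (c₂ ^ i)⁻¹ := mul_comm _ _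
    rw [this]; exact hi
  have hgen := forall_exists_pow_eq_of_map hP hcyc hP₂ hy f (QuotientGroup.mk' N d) hfd
  intro x
  obtain ⟨i, hi⟩ := hgen (QuotientGroup.mk' N x)
  refine ⟨i, ?_⟩
  rw [← map_pow, QuotientGroup.mk'_apply, QuotientGroup.mk'_apply, QuotientGroup.eq] at hi
  have : (d ^ i)⁻¹ * x = x * (d ^ i)⁻¹ := mul_comm _ _
  rw [← this]; exact hi

/-- **Coherent generators of the layers**: classes `d_n ∈ Pic(𝒪_{p^{n+1}})` with `res d_{n+1} = d_n`, each generating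
`Pic(𝒪_{p^{n+1}})` modulo `Δ` — the images of one topological generator of `G_∞ = G̃_∞/Δ ≅ ℤ_p` (a generator of `Q_2` lifted
coherently up the tower, restricted down to `Q_1`). [cite: BertoliniDarmon2005, §1.2 (18)–(21)] [cite: Washington1997, §13.2] -/
theorem exists_coherent_generators_mod_torsionImage (hK : IsImaginaryQuadratic K) (hp2 : p ≠ 2) :
    ∃ d : ∀ n : ℕ, ClassGroup (quadOrder K (p ^ (n + 1))),
      (∀ n, picRes K (pow_dvd_pow p (n + 1).le_succ) (d (n + 1)) = d n) ∧
      ∀ n (x : ClassGroup (quadOrder K (p ^ (n + 1)))), ∃ i : ℕ, x * (d n ^ i)⁻¹ ∈ torsionImage K p (n + 1) := by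
  classical
  obtain ⟨c₂, hc₂⟩ := exists_generator_mod_torsionImage p hK hp2 1
  -- lift c₂ coherently: e n ∈ G̃_{n+2}
  have hsurj : ∀ (n : ℕ) (x : ClassGroup (quadOrder K (p ^ (n + 2)))),
      ∃ y : ClassGroup (quadOrder K (p ^ (n + 3))), picRes K (pow_dvd_pow p (n + 2).le_succ) y = x :=
    fun n x => picRes_surjective_tower p hK 1 (n + 1) (n + 3) (by omega) x
  let e : ∀ n : ℕ, ClassGroup (quadOrder K (p ^ (n + 2))) := fun n =>
    Nat.rec (motive := fun n => ClassGroup (quadOrder K (p ^ (n + 2)))) c₂ (fun n en => Classical.choose (hsurj n en)) n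
  have he0 : e 0 = c₂ := rfl
  have hesucc : ∀ n, picRes K (pow_dvd_pow p (n + 2).le_succ) (e (n + 1)) = e n := fun n =>
    Classical.choose_spec (hsurj n (e n))
  have heres : ∀ n, picRes K (pow_dvd_pow p (by omega : 2 ≤ n + 2)) (e n) = c₂ := by
    intro n
    induction n with
    | zero => exact (picRes_self _ _).trans he0
    | succ n ih =>
      rw [← picRes_picRes (pow_dvd_pow p (by omega : 2 ≤ n + 2)) (pow_dvd_pow p (n + 2).le_succ), hesucc]; exact ih
  -- the family d: level 1 is the restriction of c₂, level n+2 is e n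
  let d : ∀ n : ℕ, ClassGroup (quadOrder K (p ^ (n + 1))) := fun n =>
    match n with
    | 0 => picRes K (pow_dvd_pow p (Nat.le_succ 1)) c₂
    | n + 1 => e n
  refine ⟨d, fun n => ?_, fun n => ?_⟩
  · cases n with
    | zero => show picRes K _ (e 0) = picRes K _ c₂; rw [he0]
    | succ n => exact hesucc n
  · cases n with
    | zero =>
      exact generates_mod_torsionImage_picRes p (Nat.le_succ 1) c₂ hc₂
        (picRes_surjective_tower p hK 1 0 2 (by omega))
    | succ n => exact generates_mod_torsionImage_of_picRes_eq p hK hp2 n c₂ hc₂ (e n) (heres n)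

/-! ### §2 The orders `#Q_{n+1} = p^{e_n}`, `e_n ≥ n` -/

/-- **`#(Pic(𝒪_{p^{n+1}})/Δ) = p^{e_n}` with `n ≤ e_n`**: the layer group is a `p`-group (part 5 §4) containing a class of order `p^n`
(part 6 §4). [cite: BertoliniDarmon2005, §1.2 (18)–(21)] -/
theorem exists_natCard_acLayerGroup_eq (hK : IsImaginaryQuadratic K) (hp2 : p ≠ 2) (n : ℕ) :
    ∃ e : ℕ, Nat.card (AcLayerGroup K p (n + 1)) = p ^ e ∧ n ≤ e := by
  classical
  haveI : ∀ m : ℕ, IsMulCommutative (ClassGroup (quadOrder K (p ^ m))) := fun m => CommMagma.to_isCommutative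
  haveI : Finite (ClassGroup (quadOrder K (p ^ (n + 1)))) := finite_classGroup (K := K) _
  obtain ⟨e, he⟩ := (IsPGroup.iff_card).mp (isPGroup_acLayerGroup p hK n)
  refine ⟨e, he, ?_⟩
  -- an element of order p^n
  cases n with
  | zero => exact Nat.zero_le _
  | succ k =>
    obtain ⟨h, hh1, hh2⟩ := exists_pow_prime_pow_not_mem p hK hp2 k
    set q := QuotientGroup.mk' (torsionImage K p (k + 2)) h with hq
    have hord : orderOf q = p ^ (k + 1) := by
      refine orderOf_eq_prime_pow ?_ ?_
      · rw [hq, ← map_pow, QuotientGroup.mk'_apply]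
        exact fun h1 => hh2 ((QuotientGroup.eq_one_iff _).mp h1)
      · rw [hq, ← map_pow, hh1, map_one]
    have hdvd : p ^ (k + 1) ∣ Nat.card (AcLayerGroup K p (k + 1 + 1)) := by
      rw [← hord]; exact orderOf_dvd_natCard q
    rw [he] at hdvd
    exact (Nat.pow_dvd_pow_iff_le_right hp.out.one_lt).mp hdvd

end Summit.BirchSwinnertonDyer.BirchSwinnertonDyer.Theorems.TowerSqrt

end
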